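import Summits.BirchSwinnertonDyer.BirchSwinnertonDyer.Theorems.PrintCf2RamifiedOffTYZMoverParity
import HarnessLib

/-!
# Crux `PrintCf2.RamifiedOffTYZOfFacts` (stmt-BirchSwinnertonDyer-20509), line `offtyz-v7`, LEAD cycle 8 (cruxlead-20509 g7):
# THE MOTION OF `P(n)` UNDER A SQUARE AS A SUM OVER ADMISSIBLE BLOCKS — `[g*g moves P(n)] = Σ_{S adm} w_S·[g fixes √−d_S]·(ρ(N_S)·x(g))`

THEOREMS ONLY (no `def`, no named fact, no `sorry`), `--supports stmt-BirchSwinnertonDyer-20509`.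
For `n = p₁⋯p_k ≡ 5 (mod 8)` square-free with the printed genus-point data (`recursion`, `scriptLSpec`), the CM-point / ring-class displays on
every block, the Frobenius hypothesis on every block `d ≡ 5 (mod 8)`, and Tian–Yuan–Zhang's Thm 1.1 (`thm11_parity_of_scriptL`), this file
rewrites the mover criterion of `…MoverSquares` (`galPt_mul_self_P_ne_iff`: parity of `ι(n) + Σ_{d} |𝓛(n/d)|·ι(d)`) as an `𝔽₂`-identity over
the admissible subsets `S ⊆ {1..k}` (`d_S = ∏_{i∈S} pᵢ ≡ 5 (mod 8)`):
  **`g*g moves P(n) ⟺ Σ_{S adm} coblockWeight p S · (1 + [g moves i] + Σ_{i∈S} [g moves i√−pᵢ]) · (Σ_{i∈S} blockRho p S i · [g moves i√−pᵢ]) = 1`**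
(`sqMover_iff_sum_blocks`), using `|𝓛(n/d_S)| ≡ coblockWeight p S` (`…MoverParity`), the block form (`…MoverBlockIndex`) and the block relation
`[g moves √−d_S] = [g moves i] + Σ_{i∈S} [g moves i√−pᵢ]` (`…MoverCoordinates`).  The sequel evaluates the sum at two bit vectors with (★).
BSD is not proved by any of this; no class is closed by this file.

References: [cite: TianYuanZhang2017, §3.1 (p0011 L53–L73), Thm. 1.1, Prop. 3.2 (1), Thm. 3.6 (1), proof of Lemma 3.21 (p0020 L27–L63)];
[cite: HeathBrown1994SelmerCongruentII, Appendix (Monsky), typescript p. 39 L13–L41]; crux note `Lines/offtyz_v7_QForm.md` §3, §11.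
-/

noncomputable section

open scoped Classical NumberField

open WeierstrassCurve WeierstrassCurve.Affine Finset Matrix Literature.NumberTheory.EllipticCurves
  Literature.NumberTheory.EllipticCurves.TianYuanZhang2017
  Literature.NumberTheory.EllipticCurves.TianYuanZhang2017.W2
  Literature.NumberTheory.EllipticCurves.HeathBrown1994
  Literature.NumberTheory.EllipticCurves.Smith2016
  Literature.NumberTheory.QuadraticFields.RingClass
  Literature.NumberTheory.QuadraticFields
  Summit.BirchSwinnertonDyer.Rank1Residual.P2.GenusPeriodTransferLayer
  Summit.BirchSwinnertonDyer.Rank1Residual.P2.ThetaDescent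
  Summit.BirchSwinnertonDyer.PrintCf2.QForm

set_option autoImplicit false

namespace Summit.BirchSwinnertonDyer.PrintCf2.MoverAssembly

variable {k : ℕ} (p : Fin k → ℕ) (hp : ∀ i, (p i).Prime) (hodd : ∀ i, Odd (p i)) (hinj : Function.Injective p)

/-! ## §1 Divisor bookkeeping for `n ≡ 5 (mod 8)` -/

include hp hinj in
/-- A sub-product equal to the full product is the full block. [cite: Smith2016CongruentDensity, §2.1 Remark 2.3] -/
theorem eq_univ_of_blockProd_eq (S : Finset (Fin k)) (h : ∏ i ∈ S, p i = ∏ i, p i) : S = univ := by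
  ext i
  simp only [mem_univ, iff_true]
  have : p i ∣ ∏ j ∈ S, p j := by rw [h]; exact dvd_prod_of_mem p (mem_univ i)
  exact (prime_dvd_blockProd_iff p hp hinj S i).mp this

/-- For `n ≡ 5 (mod 8)`: a divisor `d ≡ 5 (mod 8)` with `d ≠ n` lies in `recursionIndex n` (its cofactor is `≡ 1 (mod 8)` and `> 1`).
[cite: TianYuanZhang2017, §3.1 (p0011 L67–L70)] -/
theorem mem_recursionIndex_of_mod_eight {n d : ℕ} (h5 : n % 8 = 5) (hd : d ∈ n.divisors) (hd5 : d % 8 = 5) (hdn : d ≠ n) :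
    d ∈ recursionIndex n := by
  rw [mem_recursionIndex_iff]
  obtain ⟨hdvd, hn0⟩ := Nat.mem_divisors.mp hd
  have hdm : d * (n / d) = n := Nat.mul_div_cancel' hdvd
  have hq0 : n / d ≠ 0 := fun h => hn0 (by rw [← hdm, h, mul_zero])
  have hq1 : n / d ≠ 1 := fun h => hdn (by rw [← hdm, h, mul_one])
  have hmod : (n / d) % 8 = 1 := by
    have h1 : (5 * d) % 8 = 1 := by omega
    have h2 : (5 * n) % 8 = 1 := by omega
    have e : 5 * n = (5 * d) * (n / d) := by rw [mul_assoc, hdm]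
    have := Nat.mul_mod (5 * d) (n / d) 8
    rw [← e, h2, h1, one_mul, Nat.mod_mod] at this
    exact this.symm
  exact ⟨hd, Or.inl hd5, Or.inl hmod, Nat.lt_of_le_of_ne (Nat.one_le_iff_ne_zero.mpr hq0) (Ne.symm hq1)⟩

/-! ## §2 The mover criterion as a sum over admissible subsets -/

variable {n : ℕ} (D : GenusPointData n)

include hp hodd hinj in
/-- **`g*g` MOVES `P(n)` iff the block sum is `1`.**  For `n = p₁⋯p_k ≡ 5 (mod 8)` with the printed recursion and sign choices of `𝓛`, the
CM-point layer and ring class dictionary on every block, the Frobenius hypothesis on every block `d ≡ 5 (mod 8)`, and Thm 1.1: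
`g*g·P(n) ≠ P(n) ⟺ Σ_{S adm} w_S·(1 + [g moves i] + Σ_{i∈S} xᵢ(g))·(Σ_{i∈S} blockRho p S i·xᵢ(g)) = 1`, `xᵢ(g) = [g moves i√−pᵢ]`, `w_S = coblockWeight p S`.
[cite: TianYuanZhang2017, §3.1 (p0011 L53–L73), Thm. 1.1, Prop. 3.2 (1), Thm. 3.6 (1), proof of Lemma 3.21 (p0020 L27–L63)]
[cite: HeathBrown1994SelmerCongruentII, Appendix (Monsky), typescript p. 39 L13–L41] [cite: Smith2016CongruentDensity, Thm. 1.2] -/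
theorem sqMover_iff_sum_blocks (hn : n = ∏ i, p i) (h5 : n % 8 = 5) (hrec : D.recursion) (hLs : D.scriptLSpec)
    (z : ℕ → APoint D.H) (Φ : ℕ → Finset (D.H ≃ₐ[ℚ] D.H)) (ΓH ΓH' : ℕ → Subgroup (D.H ≃ₐ[ℚ] D.H))
    (σ : ℕ → (D.H ≃ₐ[ℚ] D.H)) (c : D.H ≃ₐ[ℚ] D.H) (ρ : (d : ℕ) → (D.galK d →* RingClassGroup (GenusField d) 2))
    (hc : D.ConjSpec c)
    (hblock : ∀ d ∈ n.divisors, ((d % 8 = 5 ∨ d % 8 = 6) → D.CMBlockSpec d (z d) (Φ d) (ΓH d) (ΓH' d) (σ d) c) ∧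
      (d % 8 = 7 → D.SevenBlockSpec d))
    (hring : ∀ d ∈ n.divisors, d % 8 = 5 → D.RingClassTwoBlockSpec d (ΓH d) (ΓH' d) (ρ d))
    (hFrob : ∀ d ∈ n.divisors, d % 8 = 5 → ∀ q : ℕ, q.Prime → q ∣ d → ∃ φ : D.H ≃ₐ[ℚ] D.H,
      φ (D.sqrtNeg d) = D.sqrtNeg d ∧ φ * φ ∈ ΓH' d ∧ φ D.im = (jacobiSym (-1) q) • D.im ∧
        ∀ r : ℕ, r.Prime → r ∣ n → r ≠ q → φ (D.sqrtNeg r) = (jacobiSym (-(r : ℤ)) q) • D.sqrtNeg r)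
    (h11 : thm11_parity_of_scriptL) (g : D.H ≃ₐ[ℚ] D.H) :
    D.galPt (g * g) (D.P n) ≠ D.P n ↔
      (∑ S : Finset (Fin k), (if (∏ i ∈ S, p i) % 8 = 5 then
          coblockWeight p S *
            (1 + ((if g D.im = D.im then (0 : ZMod 2) else 1) +
              ∑ i ∈ S, (if g (D.im * D.sqrtNeg (p i)) = D.im * D.sqrtNeg (p i) then (0 : ZMod 2) else 1))) *
            ∑ i ∈ S, blockRho p S i * (if g (D.im * D.sqrtNeg (p i)) = D.im * D.sqrtNeg (p i) then (0 : ZMod 2) else 1)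
        else 0)) = 1 := by
  have hsq : Squarefree n := by rw [hn]; exact squarefree_prod_of_injective p hp hinj
  have hn0 : n ≠ 0 := hsq.ne_zero
  have hnn : n ∈ n.divisors := Nat.mem_divisors_self n hn0
  -- the block motions `ι(d)` of `…MoverSquares`
  set ι : ℕ → ℕ := fun d =>
    if d % 8 = 5 ∧ g (D.sqrtNeg d) = D.sqrtNeg d ∧ (g * g) ^ gK d * (σ d)⁻¹ ∈ ΓH' d then 1 else 0 with hι
  rw [galPt_mul_self_P_ne_iff D hsq (Or.inl h5) hrec z Φ ΓH ΓH' σ c hc hblock g, odd_iff_natCast_zmod_two_eq_one,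
    Nat.cast_add, Nat.cast_sum]
  rw [Finset.sum_congr rfl (fun d _ => Nat.cast_mul ((D.scriptL (n / d)).natAbs) (ι d))]
  -- Step 1: the sum over `recursionIndex n` is the sum over all proper divisors (the other terms vanish)
  set F : ℕ → ZMod 2 := fun d => (if d = n then 1 else (((D.scriptL (n / d)).natAbs : ℕ) : ZMod 2)) * (ι d : ZMod 2) with hF
  have hsum : ((ι n : ℕ) : ZMod 2) + ∑ d ∈ recursionIndex n, (((D.scriptL (n / d)).natAbs : ℕ) : ZMod 2) * ((ι d : ℕ) : ZMod 2) =
      ∑ d ∈ n.divisors, F d := by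
    rw [← Finset.add_sum_erase _ _ hnn]
    congr 1
    · simp only [hF, if_true, one_mul]
    · have hsub : recursionIndex n ⊆ n.divisors.erase n := by
        intro d hd
        rw [mem_recursionIndex_iff] at hd
        refine mem_erase.mpr ⟨?_, hd.1⟩
        rintro rfl
        have : d / d = 1 := Nat.div_self (Nat.pos_of_mem_divisors hd.1)
        omega
      rw [← Finset.sum_subset hsub]
      · refine Finset.sum_congr rfl fun d hd => ?_
        have hdn : d ≠ n := by
          rintro rfl
          rw [mem_recursionIndex_iff] at hd
          have : d / d = 1 := Nat.div_self (Nat.pos_of_mem_divisors hd.1)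
          omega
        simp only [hF, if_neg hdn]
      · intro d hd hdn
        obtain ⟨hne, hdd⟩ := mem_erase.mp hd
        have h5d : ¬ d % 8 = 5 := fun h5d => hdn (mem_recursionIndex_of_mod_eight h5 hdd h5d hne)
        have hι0 : ι d = 0 := by
          simp only [hι]
          rw [if_neg]
          exact fun h => h5d h.1
        simp only [hF, hι0, Nat.cast_zero, mul_zero]
  have hdiv : n.divisors = (∏ i, p i).divisors := by rw [hn]
  rw [hsum, hdiv, ← sum_powerset_eq_sum_divisors p hp hinj F]
  -- Step 2: blockwise identification
  have hterm : ∀ S : Finset (Fin k), F (∏ i ∈ S, p i) = (if (∏ i ∈ S, p i) % 8 = 5 then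
      coblockWeight p S *
        (1 + ((if g D.im = D.im then (0 : ZMod 2) else 1) +
          ∑ i ∈ S, (if g (D.im * D.sqrtNeg (p i)) = D.im * D.sqrtNeg (p i) then (0 : ZMod 2) else 1))) *
        ∑ i ∈ S, blockRho p S i * (if g (D.im * D.sqrtNeg (p i)) = D.im * D.sqrtNeg (p i) then (0 : ZMod 2) else 1)
      else 0) := by
    intro S
    by_cases hS : (∏ i ∈ S, p i) % 8 = 5
    · rw [if_pos hS]
      have hdS : (∏ i ∈ S, p i) ∈ n.divisors := by rw [hn]; exact blockProd_mem_divisors p hp S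
      -- the weight
      have hw : (if (∏ i ∈ S, p i) = n then (1 : ZMod 2) else (((D.scriptL (n / ∏ i ∈ S, p i)).natAbs : ℕ) : ZMod 2)) =
          coblockWeight p S := by
        by_cases hSu : S = univ
        · subst hSu
          rw [if_pos (by rw [hn]), coblockWeight_univ]
        · rw [if_neg (fun h => hSu (eq_univ_of_blockProd_eq p hp hinj S (by rw [h, hn]))),
            scriptL_parity_eq_coblockWeight p hp hodd hinj D h11 hn h5 hLs S hS hSu]
      -- the block motion
      have hblk := sqMotion_eq_sum_blockRho_mul_bits p hp hodd hinj D hn S hS ((hblock _ hdS).1 (Or.inl hS)) (hring _ hdS hS)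
        (hFrob _ hdS hS) g
      have hrel := bit_sqrtNeg_eq_bit_im_add_sum D (blockPrimes p S) hdS (prod_blockPrimes p S) g
      have hreidx : (∑ t, (if g (D.im * D.sqrtNeg (blockPrimes p S t)) = D.im * D.sqrtNeg (blockPrimes p S t) then (0 : ZMod 2) else 1)) =
          ∑ i ∈ S, (if g (D.im * D.sqrtNeg (p i)) = D.im * D.sqrtNeg (p i) then (0 : ZMod 2) else 1) := by
        simp only [blockPrimes_apply]
        rw [← sum_coe_sort S]
        exact (S.orderIsoOfFin rfl).toEquiv.sum_comp
          (fun x : {x // x ∈ S} => if g (D.im * D.sqrtNeg (p (x : Fin k))) = D.im * D.sqrtNeg (p (x : Fin k)) then (0 : ZMod 2) else 1)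
      rw [hreidx] at hrel
      simp only [hF, hι]
      rw [hw]
      by_cases hfix : g (D.sqrtNeg (∏ i ∈ S, p i)) = D.sqrtNeg (∏ i ∈ S, p i)
      · rw [if_pos hfix] at hrel
        rw [← hrel, add_zero, mul_one, ← hblk hfix]
        by_cases hmem : (g * g) ^ gK (∏ i ∈ S, p i) * (σ (∏ i ∈ S, p i))⁻¹ ∈ ΓH' (∏ i ∈ S, p i)
        · rw [if_pos ⟨hS, hfix, hmem⟩, if_pos hmem, Nat.cast_one]
        · rw [if_neg (fun h => hmem h.2.2), if_neg hmem, Nat.cast_zero]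
      · rw [if_neg hfix] at hrel
        rw [← hrel, if_neg (fun h => hfix h.2.1), Nat.cast_zero, mul_zero, CharTwo.add_self_eq_zero, mul_zero, zero_mul]
    · rw [if_neg hS]
      have hι0 : ι (∏ i ∈ S, p i) = 0 := by
        simp only [hι]
        rw [if_neg]
        exact fun h => hS h.1
      simp only [hF, hι0, Nat.cast_zero, mul_zero]
  rw [Finset.sum_congr rfl (fun S _ => hterm S)]

end Summit.BirchSwinnertonDyer.PrintCf2.MoverAssembly

end
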